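import Summits.QuantumFields.YangMills.Theorems.BalabanLadderUVSeamRecCeilingsDLRPeelingExpWeights
import HarnessLib

/-!
# Crux `UVSeamRec` (stmt-QuantumFields-20043), lane B: the exponential-weight peeling engine for ABSTRACT LOCAL EVENTS attached to
# block-plaquettes, and Hölder over an arbitrary finite partition

Helper file (`--supports stmt-QuantumFields-20043`) of the width-lever seat `ym-20043-ceilings-p2` (lane B, gen 9); generalises gen 8's
`…CeilingsDLRPeelingExpWeights` (`torusE_exp_sum_indicator_le_of_uniformKernelBound`: exponential moments of a weighted count of N20's
LARGE-FIELD EVENTS `largeFieldEvent 𝔟 ε γ` on a window family from the one-box bound (UCR_k)) to an ARBITRARY family of measurable events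
`E i` attached INJECTIVELY to level-`k` block-plaquettes `blk i` — each `1_{E i}` a cylinder observable on the true support box
`b^k y + [0, 4b^k)⁴` of `blk i = (k, y, μ<ν)` whose cube-kernel mean over the collar cube (corner `b^k(y − m)`, side `(2m+1)b^k`, `m ≥ 3`) is
`≤ w i` for EVERY exterior — with PER-INDEX weights `w i`.  The sequel `…CeilingsGuardedPeelingEvents` instantiates it with the GUARDED
large-field events `largeFieldEvent 𝔟 e γ ∖ largeFieldEvent 𝔟 (ρe) (parent γ)` (a level-`k` block plaquette is large but its b-adic `s`-parent is
not `ρ`-large), attached to the parent.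
* `integral_exp_sum_le_of_partition` — Hölder over a finite partition (abstract probability space): if every class of a partition of the index
  set into `M` classes obeys the law `∫exp(Σ t_i χ_i) ≤ exp((1/K')Σ(e^{K't_i} − 1)θ_i)` for all `t ≥ 0`, the whole set obeys it with `K' ↦ M·K'`
  (the factor goes INSIDE the weight; gen 8 used the instances "16 sign classes" and "`256(2m+4)⁴` colour classes").
* `torusE_prod_expWeight_localEvent_le`, `torusE_exp_sum_localEvent_le_of_windowDisjoint` — peeling of the exponential weights
  `exp(t_i(1_{E i} − 1))` on ONE window-disjoint class (g6's engine `torusE_prod_le_prod_of_kerE_le`).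
* `torusE_exp_sum_localEvent_le_of_kernelBound` — for a window family (all blocks `blk i`, `i ∈ A`, in one period window, `blk` injective on
  `A`, torus holding the collar cube): `⟨exp(Σ_{i∈A} t_i 1_{E i}∘lift)⟩_{2L+1,β} ≤ exp((1/K)Σ_{i∈A}(e^{K t_i} − 1) w_i)`, `K = 256(2m+4)⁴`.
HONEST FRAMING.  Folklore probability (DLR peeling + Hölder); no large-field input is asserted; nothing of E0′; not a gap, not Clay.
References: folklore.
-/

set_option autoImplicit false

noncomputable section

open MeasureTheory Filter Topology Finset
open Literature.MathematicalPhysics.QuantumFieldTheory (GaugeConfig wilsonMeasure LatticeRep isProbabilityMeasure_wilsonMeasure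
  measurable_torusLift)
open Literature.MathematicalPhysics.QuantumLattice (LGConfig torusLift IsCylinder ymSpecification isProbabilityMeasure_ymSpecification
  integrable_of_abs_le)

namespace Summit.QuantumFields.YangMills.Cruxes.UVSeamRec.DLRPeeling

open Summit.QuantumFields.YangMills.Cruxes.OSLegsFromFemtoAndGap.DlrCollarTransfer
open Summit.QuantumFields.YangMills.Cruxes.UVSeamRec.PolymerData
open Summit.QuantumFields.YangMills.Cruxes.UVSeamRec.BlockFieldLocality

/-! ## §1 Hölder over a finite partition: the class count goes inside the exponential weight -/

section Partition

/-- **HÖLDER OVER A FINITE PARTITION.**  On a probability space, `[0,1]`-valued measurable `χ_i` (`i ∈ S`), a map `cls : ι → κ` into a finite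
type with `M = #κ > 0` elements, a constant `K' > 0` and weights `θ_i`.  If EVERY class `{i ∈ S | cls i = c}` obeys, for all coefficients `t ≥ 0`,
`∫exp(Σ_{cls i = c} t_i χ_i) ≤ exp((1/K')·Σ_{cls i = c}(e^{K' t_i} − 1)·θ_i)`, then for all `t ≥ 0`
`∫exp(Σ_{i∈S} t_i χ_i) ≤ exp((1/(M K'))·Σ_{i∈S}(e^{M K' t_i} − 1)·θ_i)` — apply the class law with coefficients `M t` and the generalised Hölder
inequality with all exponents `M` (g3's `PolymerRarity.integral_exp_sum_le_exp_sum_of_holder`). [folklore] -/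
theorem integral_exp_sum_le_of_partition {Ω : Type*} [MeasurableSpace Ω] (μ : Measure Ω) [IsProbabilityMeasure μ]
    {ι κ : Type*} [Fintype κ] [DecidableEq κ] (hκ : 0 < Fintype.card κ)
    (S : Finset ι) (χ : ι → Ω → ℝ) (hχm : ∀ i ∈ S, Measurable (χ i)) (hχ01 : ∀ i ∈ S, ∀ ω, 0 ≤ χ i ω ∧ χ i ω ≤ 1)
    (cls : ι → κ) {K' : ℝ} (hK' : 0 < K') (θ : ι → ℝ)
    (hlaw : ∀ c : κ, ∀ t : ι → ℝ, (∀ i ∈ S, 0 ≤ t i) →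
      ∫ ω, Real.exp (∑ i ∈ S.filter (fun i => cls i = c), t i * χ i ω) ∂μ ≤
        Real.exp (1 / K' * ∑ i ∈ S.filter (fun i => cls i = c), (Real.exp (K' * t i) - 1) * θ i))
    (t : ι → ℝ) (ht : ∀ i ∈ S, 0 ≤ t i) :
    ∫ ω, Real.exp (∑ i ∈ S, t i * χ i ω) ∂μ ≤
      Real.exp (1 / (Fintype.card κ * K') * ∑ i ∈ S, (Real.exp (Fintype.card κ * K' * t i) - 1) * θ i) := by
  classical
  set M : ℝ := (Fintype.card κ : ℝ) with hMdef
  have hM0 : 0 < M := by rw [hMdef]; exact_mod_cast hκ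
  let fam : κ → Finset ι := fun c => S.filter fun i => cls i = c
  have hfamS : ∀ c, fam c ⊆ S := fun c => Finset.filter_subset _ _
  -- per class: the law with coefficients `M t`
  have hclass : ∀ c, ∫ ω, Real.exp (M * ∑ i ∈ fam c, t i * χ i ω) ∂μ ≤
      Real.exp (M * (1 / (M * K') * ∑ i ∈ fam c, (Real.exp (M * K' * t i) - 1) * θ i)) := by
    intro c
    have h := hlaw c (fun i => M * t i) (fun i hi => mul_nonneg hM0.le (ht i hi))
    have e1 : M * (1 / (M * K') * ∑ i ∈ fam c, (Real.exp (M * K' * t i) - 1) * θ i) =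
        1 / K' * ∑ i ∈ fam c, (Real.exp (K' * (M * t i)) - 1) * θ i := by
      rw [← mul_assoc, show M * (1 / (M * K')) = 1 / K' by field_simp]
      refine congrArg _ (Finset.sum_congr rfl fun i _ => by ring_nf)
    rw [e1]
    refine (le_of_eq ?_).trans h
    refine integral_congr_ae (ae_of_all _ fun ω => ?_)
    simp only [Finset.mul_sum]
    refine congrArg Real.exp (Finset.sum_congr rfl fun i _ => by ring)
  have key := PolymerRarity.integral_exp_sum_le_exp_sum_of_holder μ (Finset.univ : Finset κ)
    (fun c ω => ∑ i ∈ fam c, t i * χ i ω)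
    (fun c _ => Finset.measurable_sum _ fun i hi => (hχm i (hfamS c hi)).const_mul _)
    (fun c => ∑ i ∈ fam c, t i)
    (fun c _ ω => by
      rw [abs_of_nonneg (Finset.sum_nonneg fun i hi => mul_nonneg (ht i (hfamS c hi)) (hχ01 i (hfamS c hi) ω).1)]
      exact Finset.sum_le_sum fun i hi => by
        simpa using mul_le_mul_of_nonneg_left (hχ01 i (hfamS c hi) ω).2 (ht i (hfamS c hi)))
    (fun _ => M) (fun c => 1 / (M * K') * ∑ i ∈ fam c, (Real.exp (M * K' * t i) - 1) * θ i) (fun _ _ => hM0)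
    (by rw [Finset.sum_const, Finset.card_univ, nsmul_eq_mul, ← hMdef, mul_one_div_cancel hM0.ne'])
    (fun c _ => hclass c)
  have hsumF : ∀ ω, ∑ c, ∑ i ∈ fam c, t i * χ i ω = ∑ i ∈ S, t i * χ i ω := fun ω =>
    Finset.sum_fiberwise S cls fun i => t i * χ i ω
  have hsumC : ∑ c, 1 / (M * K') * ∑ i ∈ fam c, (Real.exp (M * K' * t i) - 1) * θ i =
      1 / (M * K') * ∑ i ∈ S, (Real.exp (M * K' * t i) - 1) * θ i := by
    rw [← Finset.mul_sum, Finset.sum_fiberwise S cls fun i => (Real.exp (M * K' * t i) - 1) * θ i]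
  simp only [hsumF] at key
  rw [hsumC] at key
  exact key

end Partition

/-! ## §2 Peeling exponential weights of abstract local events on one window-disjoint class -/

section OneClass

variable {N : ℕ} (r : LatticeRep (Matrix.specialUnitaryGroup (Fin N) ℂ))

/-- **PEELING THE EXPONENTIAL WEIGHTS OF LOCAL EVENTS ON ONE WINDOW-DISJOINT CLASS.**  `SU(N)`, any lattice representation, any `β`; block size
`𝔟`, collar `m ≥ 3`, level `k`, torus `2L+1`; a finite index set `C` with block-plaquettes `blk i` of level `k`, measurable events `E i` whose
indicators are cylinder observables on the true support box `b^k y + [0,4b^k)⁴` of `blk i = (k, y, μ<ν)`, weights `w i ≥ 0` bounding the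
cube-kernel means over the collar cube (corner `b^k(y − m)`, side `(2m+1)b^k`) for EVERY exterior; the collar cubes sit in one engine window
`lo + [1, 2L−1−side]` and are pairwise window-disjoint; coefficients `t_i ≥ 0`.  Then
`⟨∏_{i∈C} exp(t_i(1_{E i}∘lift − 1))⟩_{2L+1,β} ≤ ∏_{i∈C} (e^{−t_i} + (1 − e^{−t_i}) w_i)`. [folklore] -/
theorem torusE_prod_expWeight_localEvent_le (β : ℝ) (𝔟 : BlockSize) (m : ℕ) (hm : 3 ≤ m) (k L : ℕ)
    {ι : Type*} (C : Finset ι) (blk : ι → Polymer) (hCk : ∀ i ∈ C, (blk i).k = k)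
    (E : ι → Set (LGConfig 4 (Matrix.specialUnitaryGroup (Fin N) ℂ))) (hEm : ∀ i ∈ C, MeasurableSet (E i))
    (hEloc : ∀ i ∈ C, IsCylinder ((E i).indicator fun _ => (1 : ℝ))
      ((Fintype.piFinset fun c => Finset.Ico ((𝔟.b : ℤ) ^ (blk i).k * (blk i).y c)
        ((𝔟.b : ℤ) ^ (blk i).k * (blk i).y c + 4 * (𝔟.b : ℤ) ^ (blk i).k)) ×ˢ (Finset.univ : Finset (Fin 4))))
    (w : ι → ℝ) (hw0 : ∀ i ∈ C, 0 ≤ w i)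
    (hker : ∀ i ∈ C, ∀ η : LGConfig 4 (Matrix.specialUnitaryGroup (Fin N) ℂ),
      kerE (Matrix.specialUnitaryGroup (Fin N) ℂ) r β (fun c => (𝔟.b : ℤ) ^ k * ((blk i).y c - m)) ((2 * m + 1) * 𝔟.b ^ k) η
        ((E i).indicator fun _ => (1 : ℝ)) ≤ w i)
    (lo : Fin 4 → ℤ)
    (hlo : ∀ i ∈ C, ∀ j, lo j + 1 ≤ (𝔟.b : ℤ) ^ k * ((blk i).y j - m) ∧
      (𝔟.b : ℤ) ^ k * ((blk i).y j - m) + (((2 * m + 1) * 𝔟.b ^ k : ℕ) : ℤ) + 2 ≤ lo j + (2 * L + 1 : ℕ))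
    (hdisj : ∀ i ∈ C, ∀ i' ∈ C, i ≠ i' → ∃ j,
      (𝔟.b : ℤ) ^ k * ((blk i).y j - m) + (((2 * m + 1) * 𝔟.b ^ k : ℕ) : ℤ) + 1 ≤ (𝔟.b : ℤ) ^ k * ((blk i').y j - m) ∨
      (𝔟.b : ℤ) ^ k * ((blk i').y j - m) + (((2 * m + 1) * 𝔟.b ^ k : ℕ) : ℤ) + 1 ≤ (𝔟.b : ℤ) ^ k * ((blk i).y j - m))
    (t : ι → ℝ) (ht : ∀ i ∈ C, 0 ≤ t i) :
    torusE (Matrix.specialUnitaryGroup (Fin N) ℂ) r β L (fun U => ∏ i ∈ C,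
        Real.exp (t i * ((E i).indicator (fun _ => (1 : ℝ)) U - 1))) ≤
      ∏ i ∈ C, (Real.exp (-t i) + (1 - Real.exp (-t i)) * w i) := by
  classical
  have hχ01 : ∀ i (U : LGConfig 4 (Matrix.specialUnitaryGroup (Fin N) ℂ)),
      0 ≤ (E i).indicator (fun _ => (1 : ℝ)) U ∧ (E i).indicator (fun _ => (1 : ℝ)) U ≤ 1 := fun i U =>
    ⟨Set.indicator_nonneg (fun _ _ => zero_le_one) _, Set.indicator_apply_le' (fun _ => le_rfl) (fun _ => zero_le_one)⟩
  refine torusE_prod_le_prod_of_kerE_le (Matrix.specialUnitaryGroup (Fin N) ℂ) r β L lo C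
    (fun i c => (𝔟.b : ℤ) ^ k * ((blk i).y c - m)) (fun _ => (2 * m + 1) * 𝔟.b ^ k) hlo hdisj
    (fun i U => Real.exp (t i * ((E i).indicator (fun _ => (1 : ℝ)) U - 1)))
    (fun i hi => ((measurable_const.indicator (hEm i hi)).sub_const _ |>.const_mul _).exp)
    (fun i hi U => ⟨(Real.exp_pos _).le, ?_⟩)
    (fun i => (Fintype.piFinset fun c => Finset.Ico ((𝔟.b : ℤ) ^ (blk i).k * (blk i).y c)
      ((𝔟.b : ℤ) ^ (blk i).k * (blk i).y c + 4 * (𝔟.b : ℤ) ^ (blk i).k)) ×ˢ (Finset.univ : Finset (Fin 4)))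
    (fun i hi => ?_) (fun i hi e he j => ?_)
    (fun i => Real.exp (-t i) + (1 - Real.exp (-t i)) * w i) (fun i hi => ?_) (fun i hi η => ?_)
  · -- values in `[0,1]`
    rw [Real.exp_le_one_iff]
    exact mul_nonpos_of_nonneg_of_nonpos (ht i hi) (by linarith [(hχ01 i U).2])
  · -- cylinder on the true support
    intro U V hUV
    have h := hEloc i hi hUV
    simp only at h ⊢
    rw [h]
  · -- the support sits in the collar cube window
    have hk := hCk i hi
    have h := localBox_window 𝔟 m hm (blk i).k (blk i).y he j
    rw [hk] at h
    exact h
  · -- nonnegative weights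
    have h1 : 0 ≤ 1 - Real.exp (-t i) := by
      have : Real.exp (-t i) ≤ 1 := by rw [Real.exp_le_one_iff]; linarith [ht i hi]
      linarith
    have := hw0 i hi
    positivity
  · -- the kernel bound, by linearity
    exact kerE_expWeight_le r β _ _ η (hEm i hi) (ht i hi) (hker i hi η)

/-- **EXPONENTIAL MOMENTS OF LOCAL EVENTS ON ONE WINDOW-DISJOINT CLASS**:  under the hypotheses of `torusE_prod_expWeight_localEvent_le`,
`⟨exp(Σ_{i∈C} t_i 1_{E i}∘lift)⟩ ≤ ∏_{i∈C} (1 + (e^{t_i} − 1)w_i) ≤ exp(Σ_{i∈C}(e^{t_i} − 1)w_i)`. [folklore] -/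
theorem torusE_exp_sum_localEvent_le_of_windowDisjoint (β : ℝ) (𝔟 : BlockSize) (m : ℕ) (hm : 3 ≤ m) (k L : ℕ)
    {ι : Type*} (C : Finset ι) (blk : ι → Polymer) (hCk : ∀ i ∈ C, (blk i).k = k)
    (E : ι → Set (LGConfig 4 (Matrix.specialUnitaryGroup (Fin N) ℂ))) (hEm : ∀ i ∈ C, MeasurableSet (E i))
    (hEloc : ∀ i ∈ C, IsCylinder ((E i).indicator fun _ => (1 : ℝ))
      ((Fintype.piFinset fun c => Finset.Ico ((𝔟.b : ℤ) ^ (blk i).k * (blk i).y c)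
        ((𝔟.b : ℤ) ^ (blk i).k * (blk i).y c + 4 * (𝔟.b : ℤ) ^ (blk i).k)) ×ˢ (Finset.univ : Finset (Fin 4))))
    (w : ι → ℝ) (hw0 : ∀ i ∈ C, 0 ≤ w i)
    (hker : ∀ i ∈ C, ∀ η : LGConfig 4 (Matrix.specialUnitaryGroup (Fin N) ℂ),
      kerE (Matrix.specialUnitaryGroup (Fin N) ℂ) r β (fun c => (𝔟.b : ℤ) ^ k * ((blk i).y c - m)) ((2 * m + 1) * 𝔟.b ^ k) η
        ((E i).indicator fun _ => (1 : ℝ)) ≤ w i)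
    (lo : Fin 4 → ℤ)
    (hlo : ∀ i ∈ C, ∀ j, lo j + 1 ≤ (𝔟.b : ℤ) ^ k * ((blk i).y j - m) ∧
      (𝔟.b : ℤ) ^ k * ((blk i).y j - m) + (((2 * m + 1) * 𝔟.b ^ k : ℕ) : ℤ) + 2 ≤ lo j + (2 * L + 1 : ℕ))
    (hdisj : ∀ i ∈ C, ∀ i' ∈ C, i ≠ i' → ∃ j,
      (𝔟.b : ℤ) ^ k * ((blk i).y j - m) + (((2 * m + 1) * 𝔟.b ^ k : ℕ) : ℤ) + 1 ≤ (𝔟.b : ℤ) ^ k * ((blk i').y j - m) ∨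
      (𝔟.b : ℤ) ^ k * ((blk i').y j - m) + (((2 * m + 1) * 𝔟.b ^ k : ℕ) : ℤ) + 1 ≤ (𝔟.b : ℤ) ^ k * ((blk i).y j - m))
    (t : ι → ℝ) (ht : ∀ i ∈ C, 0 ≤ t i) :
    torusE (Matrix.specialUnitaryGroup (Fin N) ℂ) r β L (fun U => Real.exp (∑ i ∈ C,
        t i * (E i).indicator (fun _ => (1 : ℝ)) U)) ≤
      Real.exp (∑ i ∈ C, (Real.exp (t i) - 1) * w i) := by
  classical
  have hpeel := torusE_prod_expWeight_localEvent_le r β 𝔟 m hm k L C blk hCk E hEm hEloc w hw0 hker lo hlo hdisj t ht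
  set P : ℝ := ∏ i ∈ C, Real.exp (t i) with hP
  have hP0 : 0 ≤ P := Finset.prod_nonneg fun i _ => (Real.exp_pos _).le
  have hpt : ∀ U : LGConfig 4 (Matrix.specialUnitaryGroup (Fin N) ℂ),
      Real.exp (∑ i ∈ C, t i * (E i).indicator (fun _ => (1 : ℝ)) U) =
        P * ∏ i ∈ C, Real.exp (t i * ((E i).indicator (fun _ => (1 : ℝ)) U - 1)) := by
    intro U
    rw [Real.exp_sum, hP, ← Finset.prod_mul_distrib]
    refine Finset.prod_congr rfl fun i _ => ?_
    rw [← Real.exp_add]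
    congr 1
    ring
  have hlhs : torusE (Matrix.specialUnitaryGroup (Fin N) ℂ) r β L (fun U => Real.exp (∑ i ∈ C,
        t i * (E i).indicator (fun _ => (1 : ℝ)) U)) =
      P * torusE (Matrix.specialUnitaryGroup (Fin N) ℂ) r β L (fun U => ∏ i ∈ C,
        Real.exp (t i * ((E i).indicator (fun _ => (1 : ℝ)) U - 1))) := by
    unfold torusE
    rw [← integral_const_mul]
    exact integral_congr_ae (ae_of_all _ fun U => hpt _)
  rw [hlhs]
  calc P * torusE (Matrix.specialUnitaryGroup (Fin N) ℂ) r β L (fun U => ∏ i ∈ C,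
          Real.exp (t i * ((E i).indicator (fun _ => (1 : ℝ)) U - 1)))
      ≤ P * ∏ i ∈ C, (Real.exp (-t i) + (1 - Real.exp (-t i)) * w i) := mul_le_mul_of_nonneg_left hpeel hP0
    _ = ∏ i ∈ C, (1 + (Real.exp (t i) - 1) * w i) := by
        rw [hP, ← Finset.prod_mul_distrib]
        exact Finset.prod_congr rfl fun i _ => exp_mul_expWeightBound (t i) (w i)
    _ ≤ ∏ i ∈ C, Real.exp ((Real.exp (t i) - 1) * w i) := by
        refine Finset.prod_le_prod (fun i hi => ?_) fun i hi => ?_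
        · have : 0 ≤ (Real.exp (t i) - 1) * w i :=
            mul_nonneg (by linarith [Real.one_le_exp (ht i hi)]) (hw0 i hi)
          linarith
        · have := Real.add_one_le_exp ((Real.exp (t i) - 1) * w i)
          linarith
    _ = Real.exp (∑ i ∈ C, (Real.exp (t i) - 1) * w i) := by rw [Real.exp_sum]

end OneClass

/-! ## §3 The window family of abstract local events: colouring and Hölder, `K = 256(2m+4)⁴` inside the weight -/

section Window

variable {N : ℕ} (r : LatticeRep (Matrix.specialUnitaryGroup (Fin N) ℂ))

/-- **EXPONENTIAL MOMENTS OF A WEIGHTED COUNT OF LOCAL EVENTS ON A WINDOW FAMILY — PER-INDEX WEIGHTS, NO ROOT.**  `SU(N)`, any lattice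
representation, any `β`; ANY odd block size `𝔟`, collar `m ≥ 3`, level `k`, odd torus `2L+1` holding the collar cube (`(2m+1)b^k + 3 ≤ 2L+1`).
A finite index set `A` with level-`k` block-plaquettes `blk i` attached INJECTIVELY (`blk` injective on `A`), all blocks in one period window
`[o, o + 2L+1)⁴`; measurable events `E i` whose indicators are cylinder observables on the true support box of `blk i`; weights `w i ≥ 0` with the
one-box kernel bound `kerE^η_{collar cube of blk i}(1_{E i}) ≤ w i` for EVERY exterior `η`; coefficients `t_i ≥ 0`.  Then
`⟨exp(Σ_{i∈A} t_i·1_{E i}∘lift)⟩_{2L+1,β} ≤ exp((1/K)·Σ_{i∈A} (e^{K·t_i} − 1)·w_i)`,  `K = 256(2m+4)⁴`.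
Proof: colour the block-plaquettes `blk(A)` by gen 8's `exists_windowColouring` (every class window-disjoint with a common window), pull the
colouring back along the injective `blk`, bound each class by `torusE_exp_sum_localEvent_le_of_windowDisjoint` and combine the classes by
`integral_exp_sum_le_of_partition`.  gen 8's `torusE_exp_sum_indicator_le_of_uniformKernelBound` is the instance `blk = id`,
`E γ = largeFieldEvent 𝔟 ε γ`, constant weight. [folklore] -/
theorem torusE_exp_sum_localEvent_le_of_kernelBound (β : ℝ) (𝔟 : BlockSize) (m : ℕ) (hm : 3 ≤ m) (k L : ℕ)
    (hfit : (2 * m + 1) * 𝔟.b ^ k + 3 ≤ 2 * L + 1)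
    {ι : Type*} [DecidableEq ι] (A : Finset ι) (blk : ι → Polymer) (hinj : Set.InjOn blk A) (hAk : ∀ i ∈ A, (blk i).k = k)
    (E : ι → Set (LGConfig 4 (Matrix.specialUnitaryGroup (Fin N) ℂ))) (hEm : ∀ i ∈ A, MeasurableSet (E i))
    (hEloc : ∀ i ∈ A, IsCylinder ((E i).indicator fun _ => (1 : ℝ))
      ((Fintype.piFinset fun c => Finset.Ico ((𝔟.b : ℤ) ^ (blk i).k * (blk i).y c)
        ((𝔟.b : ℤ) ^ (blk i).k * (blk i).y c + 4 * (𝔟.b : ℤ) ^ (blk i).k)) ×ˢ (Finset.univ : Finset (Fin 4))))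
    (w : ι → ℝ) (hw0 : ∀ i ∈ A, 0 ≤ w i)
    (hker : ∀ i ∈ A, ∀ η : LGConfig 4 (Matrix.specialUnitaryGroup (Fin N) ℂ),
      kerE (Matrix.specialUnitaryGroup (Fin N) ℂ) r β (fun c => (𝔟.b : ℤ) ^ k * ((blk i).y c - m)) ((2 * m + 1) * 𝔟.b ^ k) η
        ((E i).indicator fun _ => (1 : ℝ)) ≤ w i)
    (o : Fin 4 → ℤ) (hwin : ∀ i ∈ A, ∀ c, o c ≤ anchor 𝔟 (blk i) c ∧ anchor 𝔟 (blk i) c + (𝔟.b : ℤ) ^ k ≤ o c + (2 * L + 1))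
    (t : ι → ℝ) (ht : ∀ i ∈ A, 0 ≤ t i) :
    torusE (Matrix.specialUnitaryGroup (Fin N) ℂ) r β L (fun U => Real.exp (∑ i ∈ A,
        t i * (E i).indicator (fun _ => (1 : ℝ)) U)) ≤
      Real.exp ((1 : ℝ) / (256 * (2 * m + 4) ^ 4) * ∑ i ∈ A, (Real.exp (256 * (2 * m + 4) ^ 4 * t i) - 1) * w i) := by
  classical
  haveI : NeZero (2 * m + 4) := ⟨by omega⟩
  haveI := isProbabilityMeasure_wilsonMeasure (d := 4) (L := 2 * L + 1) r.ρ r.continuous β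
  set K : ℝ := 256 * (2 * (m : ℝ) + 4) ^ 4 with hKdef
  have hK0 : 0 < K := by rw [hKdef]; positivity
  have hKcard : (Fintype.card (Fin 4 × Fin 4 × (Fin 4 → Bool) × (Fin 4 → ZMod (2 * m + 4))) : ℝ) = K := by
    rw [card_windowColour m, hKdef]; push_cast; ring
  have hcardpos : 0 < Fintype.card (Fin 4 × Fin 4 × (Fin 4 → Bool) × (Fin 4 → ZMod (2 * m + 4))) := by
    rw [card_windowColour m]; positivity
  -- the colouring of the block-plaquettes `blk(A)`, pulled back along `blk`
  have hA' : ∀ γ ∈ A.image blk, γ.k = k := by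
    intro γ hγ
    obtain ⟨i, hi, rfl⟩ := Finset.mem_image.1 hγ
    exact hAk i hi
  have hwin' : ∀ γ ∈ A.image blk, ∀ c, o c ≤ anchor 𝔟 γ c ∧ anchor 𝔟 γ c + (𝔟.b : ℤ) ^ k ≤ o c + (2 * L + 1) := by
    intro γ hγ c
    obtain ⟨i, hi, rfl⟩ := Finset.mem_image.1 hγ
    exact hwin i hi c
  obtain ⟨col, hcol⟩ := exists_windowColouring 𝔟 m k L hfit o (A.image blk) hA' hwin'
  let χ : ι → GaugeConfig 4 (2 * L + 1) (Matrix.specialUnitaryGroup (Fin N) ℂ) → ℝ := fun i U =>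
    (E i).indicator (fun _ => (1 : ℝ)) (torusLift (2 * L + 1) U)
  have hχ01 : ∀ i ∈ A, ∀ U, 0 ≤ χ i U ∧ χ i U ≤ 1 := fun i _ U =>
    ⟨Set.indicator_nonneg (fun _ _ => zero_le_one) _, Set.indicator_apply_le' (fun _ => le_rfl) (fun _ => zero_le_one)⟩
  have hχm : ∀ i ∈ A, Measurable (χ i) := fun i hi =>
    (measurable_const.indicator (hEm i hi)).comp (measurable_torusLift _)
  -- the class law (constant `1`): each colour class is window-disjoint with a common window
  have hlaw : ∀ c₀ : Fin 4 × Fin 4 × (Fin 4 → Bool) × (Fin 4 → ZMod (2 * m + 4)), ∀ t' : ι → ℝ, (∀ i ∈ A, 0 ≤ t' i) →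
      ∫ U, Real.exp (∑ i ∈ A.filter (fun i => col (blk i) = c₀), t' i * χ i U)
        ∂(wilsonMeasure (d := 4) (L := 2 * L + 1) r.ρ β) ≤
        Real.exp (1 / (1 : ℝ) * ∑ i ∈ A.filter (fun i => col (blk i) = c₀), (Real.exp ((1 : ℝ) * t' i) - 1) * w i) := by
    intro c₀ t' ht'
    set C := A.filter (fun i => col (blk i) = c₀) with hCdef
    have hCA : C ⊆ A := Finset.filter_subset _ _
    have hCimg : ∀ i ∈ C, blk i ∈ (A.image blk).filter (fun γ => col γ = c₀) := by
      intro i hi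
      obtain ⟨hiA, hic⟩ := Finset.mem_filter.1 hi
      exact Finset.mem_filter.2 ⟨Finset.mem_image_of_mem blk hiA, hic⟩
    obtain ⟨lo, hlo, hdisj⟩ := hcol c₀
    have h' := torusE_exp_sum_localEvent_le_of_windowDisjoint r β 𝔟 m hm k L C blk (fun i hi => hAk i (hCA hi)) E
      (fun i hi => hEm i (hCA hi)) (fun i hi => hEloc i (hCA hi)) w (fun i hi => hw0 i (hCA hi)) (fun i hi => hker i (hCA hi)) lo
      (fun i hi => hlo (blk i) (hCimg i hi))
      (fun i hi i' hi' hne => hdisj (blk i) (hCimg i hi) (blk i') (hCimg i' hi') fun h => hne (hinj (hCA hi) (hCA hi') h))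
      t' (fun i hi => ht' i (hCA hi))
    simp only [one_mul, div_one]
    refine (le_of_eq ?_).trans h'
    unfold torusE
    rfl
  have key := integral_exp_sum_le_of_partition (wilsonMeasure (d := 4) (L := 2 * L + 1) r.ρ β) hcardpos A χ hχm hχ01
    (fun i => col (blk i)) one_pos w hlaw t ht
  rw [hKcard, mul_one] at key
  unfold torusE
  simpa only [hKdef] using key

end Window

end Summit.QuantumFields.YangMills.Cruxes.UVSeamRec.DLRPeeling

end
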